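import Literature.NumberTheory.DiophantineGeometry.SimplestQuarticThue

/-!
# The simplest quartic Thue equations: the four real roots `β⁽ʲ⁾` of `P_t(X, 1)` [ChenVoutier1997, §3]

Proved companions of the named fact `SimplestQuarticThueSolutions` ([ChenVoutier1997, Thm 3]),
formalising the opening of [ChenVoutier1997, §3]: "For any positive integer `t`, let us define
`ε = (t + √(t² + 16))/4`, `ρ = √(1 + ε²)`, `β⁽⁰⁾ = ε − ρ`, `β⁽¹⁾ = (ρ − 1)/ε`, `β⁽²⁾ = ρ + ε` and
`β⁽³⁾ = −(ρ + 1)/ε`.  One can show that the `β⁽ʲ⁾`'s are the four roots of `P_t(X, 1)`", together with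
the size estimates on `ε`, `ρ` that feed the bounds of [ChenVoutier1997, §3.2], and the product formula
`∏ⱼ |x − β⁽ʲ⁾y| = |P_t(x, y)|` ("`δ⁽⁰⁾δ⁽¹⁾δ⁽²⁾δ⁽³⁾ = 1`", (3.17)) behind the passage from a solution of
the Thue equation to a rational approximation of one root.

Design: no new definitions — `ε` and `ρ` are section variables constrained by the hypotheses that
define them (`ε > 0`, `ε − ε⁻¹ = t/2`; `ρ > 0`, `ρ² = 1 + ε²`), instantiated by `exists_eps` /
`exists_rho`; statements are over `ℝ` with the integer form `simplestQuarticForm` cast.  The key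
identity is the factorisation `P_t(X, Y) = (X² − 2εXY − Y²)(X² + (2/ε)XY − Y²)` (the two factors
having roots `ε ± ρ` and `(−1 ± ρ)/ε`), valid exactly when `2ε − 2/ε = t`.

## References

* Chen Jian Hua, P. M. Voutier, J. Number Theory 62 (1997) 71–99 = arXiv:1401.5450, §3 (definition of
  `ε, ρ, β⁽ʲ⁾`), §3.2 (bounds, (3.17)). [ChenVoutier1997]
-/

noncomputable section

namespace Literature.NumberTheory.DiophantineGeometry

namespace SimplestQuarticThue

open Real

/-! ## `ε = (t + √(t² + 16))/4`: existence, defining relation, size -/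

/-- `ε = (t + √(t² + 16))/4` is positive and satisfies `ε − 1/ε = t/2` (equivalently
`2ε − 2/ε = t`, `ε² = (t/2)ε + 1`). [cite: ChenVoutier1997, §3] -/
theorem exists_eps (t : ℝ) : ∃ ε : ℝ, 0 < ε ∧ ε - ε⁻¹ = t / 2 := by
  have hs : 0 ≤ t ^ 2 + 16 := by positivity
  have hsq : Real.sqrt (t ^ 2 + 16) ^ 2 = t ^ 2 + 16 := Real.sq_sqrt hs
  have hgt : |t| < Real.sqrt (t ^ 2 + 16) := by
    rw [← Real.sqrt_sq_eq_abs]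
    exact Real.sqrt_lt_sqrt (sq_nonneg t) (by linarith)
  have hpos : 0 < t + Real.sqrt (t ^ 2 + 16) := by
    have := neg_abs_le t
    linarith
  refine ⟨(t + Real.sqrt (t ^ 2 + 16)) / 4, by positivity, ?_⟩
  have hne : (t + Real.sqrt (t ^ 2 + 16)) / 4 ≠ 0 := by positivity
  field_simp
  nlinarith [hsq]

variable {t ε : ℝ}

/-- From `ε − 1/ε = t/2`, `ε > 0`: the quadratic relation `ε² = (t/2)ε + 1`. [cite: ChenVoutier1997, §3] -/
theorem eps_sq (hε : 0 < ε) (h : ε - ε⁻¹ = t / 2) : ε ^ 2 = t / 2 * ε + 1 := by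
  have hne : ε ≠ 0 := hε.ne'
  field_simp at h
  nlinarith [h]

/-- Size of `ε` for `t > 0`: `t/2 < ε < t/2 + 2/t` (since `ε = t/2 + 1/ε` and `ε > t/2`).
[cite: ChenVoutier1997, §3.2] -/
theorem eps_bounds (hε : 0 < ε) (h : ε - ε⁻¹ = t / 2) (ht : 0 < t) :
    t / 2 < ε ∧ ε < t / 2 + 2 / t := by
  have h1 : ε = t / 2 + ε⁻¹ := by linarith
  have hinv : 0 < ε⁻¹ := inv_pos.2 hε
  have hlow : t / 2 < ε := by linarith
  refine ⟨hlow, ?_⟩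
  have : ε⁻¹ < 2 / t := by
    rw [inv_eq_one_div, div_lt_div_iff₀ hε ht]; linarith
  linarith

/-! ## The factorisation of `P_t` over `ℝ` and the four roots -/

/-- **`P_t(X, Y) = (X² − 2εXY − Y²)(X² + (2/ε)XY − Y²)`** whenever `ε − 1/ε = t/2`: the real
factorisation of the simplest quartic form through its quadratic subfield. [cite: ChenVoutier1997, §3] -/
theorem form_eq_mul_quadratic (hε : 0 < ε) (h : ε - ε⁻¹ = t / 2) (x y : ℝ) :
    x ^ 4 - t * x ^ 3 * y - 6 * x ^ 2 * y ^ 2 + t * x * y ^ 3 + y ^ 4 =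
      (x ^ 2 - 2 * ε * x * y - y ^ 2) * (x ^ 2 + 2 / ε * x * y - y ^ 2) := by
  have hne : ε ≠ 0 := hε.ne'
  have ht : t = 2 * ε - 2 / ε := by field_simp; field_simp at h; linarith
  rw [ht]
  field_simp
  ring

/-- The integer form, cast to `ℝ`, factors the same way. [cite: ChenVoutier1997, §3] -/
theorem cast_simplestQuarticForm_eq (hε : 0 < ε) {t : ℤ} (h : ε - ε⁻¹ = (t : ℝ) / 2) (x y : ℤ) :
    (simplestQuarticForm t x y : ℝ) =
      ((x : ℝ) ^ 2 - 2 * ε * x * y - (y : ℝ) ^ 2) * ((x : ℝ) ^ 2 + 2 / ε * x * y - (y : ℝ) ^ 2) := by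
  rw [← form_eq_mul_quadratic hε h]
  simp [simplestQuarticForm]

variable {ρ : ℝ}

/-- `ρ = √(1 + ε²)` exists: `ρ > 0`, `ρ² = 1 + ε²`. [cite: ChenVoutier1997, §3] -/
theorem exists_rho (ε : ℝ) : ∃ ρ : ℝ, 0 < ρ ∧ ρ ^ 2 = 1 + ε ^ 2 :=
  ⟨Real.sqrt (1 + ε ^ 2), Real.sqrt_pos.2 (by positivity), Real.sq_sqrt (by positivity)⟩

/-- Size of `ρ`: `ε < ρ < ε + 1/(2ε)` for `ε > 0`. [cite: ChenVoutier1997, §3.2] -/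
theorem rho_bounds (hε : 0 < ε) (hρ : 0 < ρ) (hρ2 : ρ ^ 2 = 1 + ε ^ 2) :
    ε < ρ ∧ ρ < ε + 1 / (2 * ε) := by
  constructor
  · nlinarith
  · have h1 : (ε + 1 / (2 * ε)) ^ 2 = 1 + ε ^ 2 + 1 / (4 * ε ^ 2) := by
      field_simp; ring
    have hM : 0 < ε + 1 / (2 * ε) := by positivity
    have h4 : 0 < 1 / (4 * ε ^ 2) := by positivity
    have h2 : ρ ^ 2 < (ε + 1 / (2 * ε)) ^ 2 := by rw [h1, hρ2]; linarith
    nlinarith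

/-- The roots `β⁽⁰⁾ = ε − ρ`, `β⁽²⁾ = ε + ρ` of the first quadratic factor:
`X² − 2εXY − Y² = (X − β⁽⁰⁾Y)(X − β⁽²⁾Y)`. [cite: ChenVoutier1997, §3] -/
theorem quadratic_eq_mul_root (hρ2 : ρ ^ 2 = 1 + ε ^ 2) (x y : ℝ) :
    x ^ 2 - 2 * ε * x * y - y ^ 2 = (x - (ε - ρ) * y) * (x - (ε + ρ) * y) := by
  linear_combination (y ^ 2) * hρ2

/-- The roots `β⁽¹⁾ = (ρ − 1)/ε`, `β⁽³⁾ = −(ρ + 1)/ε` of the second quadratic factor: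
`X² + (2/ε)XY − Y² = (X − β⁽¹⁾Y)(X − β⁽³⁾Y)`. [cite: ChenVoutier1997, §3] -/
theorem quadratic'_eq_mul_root (hε : 0 < ε) (hρ2 : ρ ^ 2 = 1 + ε ^ 2) (x y : ℝ) :
    x ^ 2 + 2 / ε * x * y - y ^ 2 = (x - (ρ - 1) / ε * y) * (x - -(ρ + 1) / ε * y) := by
  have hne : ε ≠ 0 := hε.ne'
  have h1 : (x - (ρ - 1) / ε * y) * (x - -(ρ + 1) / ε * y) =
      x ^ 2 + 2 / ε * x * y - (ρ ^ 2 - 1) / ε ^ 2 * y ^ 2 := by ring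
  have h2 : (ρ ^ 2 - 1) / ε ^ 2 = 1 := by
    rw [div_eq_one_iff_eq (pow_ne_zero 2 hne)]; linarith
  rw [h1, h2]; ring

/-- **The four roots** [ChenVoutier1997, §3]: with `ε − 1/ε = t/2`, `ρ² = 1 + ε²`,
`P_t(X, Y) = (X − β⁽⁰⁾Y)(X − β⁽¹⁾Y)(X − β⁽²⁾Y)(X − β⁽³⁾Y)` over `ℝ`, where
`β⁽⁰⁾ = ε − ρ`, `β⁽¹⁾ = (ρ − 1)/ε`, `β⁽²⁾ = ε + ρ`, `β⁽³⁾ = −(ρ + 1)/ε`. [cite: ChenVoutier1997, §3] -/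
theorem form_eq_prod_roots (hε : 0 < ε) (h : ε - ε⁻¹ = t / 2) (hρ2 : ρ ^ 2 = 1 + ε ^ 2) (x y : ℝ) :
    x ^ 4 - t * x ^ 3 * y - 6 * x ^ 2 * y ^ 2 + t * x * y ^ 3 + y ^ 4 =
      (x - (ε - ρ) * y) * (x - (ρ - 1) / ε * y) * (x - (ε + ρ) * y) * (x - -(ρ + 1) / ε * y) := by
  rw [form_eq_mul_quadratic hε h, quadratic_eq_mul_root hρ2, quadratic'_eq_mul_root hε hρ2]
  ring

/-- Each `β⁽ʲ⁾` is a root of `P_t(X, 1) = X⁴ − tX³ − 6X² + tX + 1`. [cite: ChenVoutier1997, §3] -/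
theorem eval_root_eq_zero (hε : 0 < ε) (h : ε - ε⁻¹ = t / 2) (hρ2 : ρ ^ 2 = 1 + ε ^ 2) {β : ℝ}
    (hβ : β = ε - ρ ∨ β = (ρ - 1) / ε ∨ β = ε + ρ ∨ β = -(ρ + 1) / ε) :
    β ^ 4 - t * β ^ 3 - 6 * β ^ 2 + t * β + 1 = 0 := by
  have e := form_eq_prod_roots hε h hρ2 β 1
  simp only [mul_one, one_pow] at e
  rw [e]
  rcases hβ with rfl | rfl | rfl | rfl <;> ring

/-- `β⁽⁰⁾β⁽²⁾ = −1` and `β⁽¹⁾β⁽³⁾ = −1` ("Since `β⁽⁰⁾β⁽²⁾ = β⁽¹⁾β⁽³⁾ = −1`", §3.1).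
[cite: ChenVoutier1997, §3.1] -/
theorem root_mul_root (hε : 0 < ε) (hρ2 : ρ ^ 2 = 1 + ε ^ 2) :
    (ε - ρ) * (ε + ρ) = -1 ∧ (ρ - 1) / ε * (-(ρ + 1) / ε) = -1 := by
  have hne : ε ≠ 0 := hε.ne'
  constructor
  · linear_combination -hρ2
  · have h1 : (ρ - 1) / ε * (-(ρ + 1) / ε) = -((ρ ^ 2 - 1) / ε ^ 2) := by ring
    rw [h1, show ρ ^ 2 - 1 = ε ^ 2 by linarith, div_self (pow_ne_zero 2 hne)]

/-- **(3.17): `δ⁽⁰⁾δ⁽¹⁾δ⁽²⁾δ⁽³⁾ = |P_t(x, y)|`** — for a solution of `P_t(x, y) = ±1` the product of the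
four distances `δ⁽ʲ⁾ = |x − β⁽ʲ⁾y|` is `1`. [cite: ChenVoutier1997, §3.2 (3.17)] -/
theorem prod_abs_sub_root_mul_eq_one (hε : 0 < ε) {t : ℤ} (h : ε - ε⁻¹ = (t : ℝ) / 2)
    (hρ2 : ρ ^ 2 = 1 + ε ^ 2) {x y : ℤ}
    (hP : simplestQuarticForm t x y = 1 ∨ simplestQuarticForm t x y = -1) :
    |(x : ℝ) - (ε - ρ) * y| * |(x : ℝ) - (ρ - 1) / ε * y| * |(x : ℝ) - (ε + ρ) * y| *
        |(x : ℝ) - -(ρ + 1) / ε * y| = 1 := by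
  have e : (simplestQuarticForm t x y : ℝ) =
      ((x : ℝ) - (ε - ρ) * y) * ((x : ℝ) - (ρ - 1) / ε * y) * ((x : ℝ) - (ε + ρ) * y) *
        ((x : ℝ) - -(ρ + 1) / ε * y) := by
    rw [← form_eq_prod_roots hε h hρ2]
    simp [simplestQuarticForm]
  have habs : |(simplestQuarticForm t x y : ℝ)| = 1 := by
    rcases hP with hP | hP <;> simp [hP]
  rw [e, abs_mul, abs_mul, abs_mul] at habs
  exact habs

/-! ## Location of the roots for `t > 0` (cf. the bounds opening [ChenVoutier1997, §3.2]) -/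

/-- `β⁽²⁾ = ε + ρ ∈ (t, t + 5/t)` for `t > 0` (printed: `t + 5/(t+1) < β⁽²⁾ < t + 5/t` for `t ≥ 5`).
[cite: ChenVoutier1997, §3.2] -/
theorem root_two_bounds (hε : 0 < ε) (h : ε - ε⁻¹ = t / 2) (ht : 0 < t) (hρ : 0 < ρ)
    (hρ2 : ρ ^ 2 = 1 + ε ^ 2) : t < ε + ρ ∧ ε + ρ < t + 5 / t := by
  obtain ⟨he1, he2⟩ := eps_bounds hε h ht
  obtain ⟨hr1, hr2⟩ := rho_bounds hε hρ hρ2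
  refine ⟨by linarith, ?_⟩
  have h3 : 1 / (2 * ε) < 1 / t := one_div_lt_one_div_of_lt ht (by linarith)
  have h4 : (5 : ℝ) / t = 2 / t + 2 / t + 1 / t := by ring
  linarith

/-- `β⁽⁰⁾ = ε − ρ = −1/β⁽²⁾ ∈ (−1/t, −1/(t + 5/t))` for `t > 0` (printed: `−1/t < β⁽⁰⁾ < −1/(t+1)` for
`t ≥ 5`; note `t + 5/t ≤ t + 1` once `t ≥ 5`). [cite: ChenVoutier1997, §3.2] -/
theorem root_zero_bounds (hε : 0 < ε) (h : ε - ε⁻¹ = t / 2) (ht : 0 < t) (hρ : 0 < ρ)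
    (hρ2 : ρ ^ 2 = 1 + ε ^ 2) : -(1 / t) < ε - ρ ∧ ε - ρ < -(1 / (t + 5 / t)) := by
  obtain ⟨h1, h2⟩ := root_two_bounds hε h ht hρ hρ2
  have hpos : 0 < ε + ρ := by linarith
  have e : ε - ρ = -(1 / (ε + ρ)) := by
    have := (root_mul_root hε hρ2).1
    field_simp
    linarith
  rw [e, neg_lt_neg_iff, neg_lt_neg_iff]
  exact ⟨one_div_lt_one_div_of_lt ht h1, one_div_lt_one_div_of_lt hpos h2⟩

/-- `β⁽¹⁾ = (ρ − 1)/ε ∈ (1 − 2/t, 1)` for `t ≥ 1` (printed: `1 − 2/(t+1) < β⁽¹⁾ < 1 − 2/(t+2)` for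
`t ≥ 5`). [cite: ChenVoutier1997, §3.2] -/
theorem root_one_bounds (hε : 0 < ε) (h : ε - ε⁻¹ = t / 2) (ht : 1 ≤ t) (hρ : 0 < ρ)
    (hρ2 : ρ ^ 2 = 1 + ε ^ 2) : 1 - 2 / t < (ρ - 1) / ε ∧ (ρ - 1) / ε < 1 := by
  obtain ⟨he1, he2⟩ := eps_bounds hε h (by linarith)
  obtain ⟨hr1, hr2⟩ := rho_bounds hε hρ hρ2
  constructor
  · -- `(ρ − 1)/ε > (ε − 1)/ε = 1 − 1/ε > 1 − 2/t`
    have h1 : 1 - 2 / t < 1 - 1 / ε := by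
      have : 1 / ε < 2 / t := by
        rw [div_lt_div_iff₀ hε (by linarith)]; linarith
      linarith
    have h2 : 1 - 1 / ε ≤ (ρ - 1) / ε := by
      rw [show 1 - 1 / ε = (ε - 1) / ε by field_simp]
      exact div_le_div_of_nonneg_right (by linarith) hε.le
    linarith
  · rw [div_lt_one hε]
    have : 1 / (2 * ε) ≤ 1 := by
      rw [div_le_one (by positivity)]; linarith
    linarith

/-- `β⁽³⁾ = −(ρ + 1)/ε = −1/β⁽¹⁾ ∈ (−1 − 2/t − 2/t², −1 − 2t/(t² + 4))` for `t ≥ 1` (printed: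
`−1 − 2/(t−1) < β⁽³⁾ < −1 − 2/t` for `t ≥ 5`). [cite: ChenVoutier1997, §3.2] -/
theorem root_three_bounds (hε : 0 < ε) (h : ε - ε⁻¹ = t / 2) (ht : 1 ≤ t) (hρ : 0 < ρ)
    (hρ2 : ρ ^ 2 = 1 + ε ^ 2) :
    -1 - 2 / t - 2 / t ^ 2 < -(ρ + 1) / ε ∧ -(ρ + 1) / ε < -1 - 2 * t / (t ^ 2 + 4) := by
  obtain ⟨he1, he2⟩ := eps_bounds hε h (by linarith)
  obtain ⟨hr1, hr2⟩ := rho_bounds hε hρ hρ2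
  have ht0 : 0 < t := by linarith
  -- `1/ε ∈ (2t/(t²+4), 2/t)` and `1/(2ε²) < 2/t²`
  have hi1 : 1 / ε < 2 / t := by rw [div_lt_div_iff₀ hε ht0]; linarith
  have hi2 : 2 * t / (t ^ 2 + 4) < 1 / ε := by
    rw [div_lt_div_iff₀ (by positivity) hε]
    have : ε * (2 * t) < (t / 2 + 2 / t) * (2 * t) := by nlinarith
    have e : (t / 2 + 2 / t) * (2 * t) = t ^ 2 + 4 := by field_simp; ring
    linarith
  have hi3 : 1 / (2 * ε ^ 2) < 2 / t ^ 2 := by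
    rw [div_lt_div_iff₀ (by positivity) (by positivity)]; nlinarith
  constructor
  · -- `(ρ+1)/ε < (ε + 1/(2ε) + 1)/ε = 1 + 1/ε + 1/(2ε²)`
    have h1 : (ρ + 1) / ε < 1 + 1 / ε + 1 / (2 * ε ^ 2) := by
      rw [show 1 + 1 / ε + 1 / (2 * ε ^ 2) = (ε + 1 / (2 * ε) + 1) / ε by field_simp; ring]
      exact div_lt_div_of_pos_right (by linarith) hε
    rw [neg_div]; linarith
  · -- `(ρ+1)/ε > (ε+1)/ε = 1 + 1/ε`
    have h1 : 1 + 1 / ε < (ρ + 1) / ε := by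
      rw [show 1 + 1 / ε = (ε + 1) / ε by field_simp]
      exact div_lt_div_of_pos_right (by linarith) hε
    rw [neg_div]; linarith

end SimplestQuarticThue

end Literature.NumberTheory.DiophantineGeometry
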